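import Summits.AtomisticToContinuum.FouriersLaw.Theorems.JunctionLocalityNonBallisticOfSubextensiveSnapshot

/-!
# Stub `stub_autocorrelationDomination` (DOM) of line `drude-controls-conductance` (R2) — crux
`JunctionLocality.NonBallistic` (stmt-AtomisticToContinuum-9127)

Helper file (`--supports stmt-AtomisticToContinuum-9127`); nothing here closes the item.

For the pinned anharmonic chain `pinnedChain ω₂ lam β γ` (all parameters `> 0`) and `T > 0`, the equilibrium
total-current autocorrelation of the OPEN chain with both Langevin baths at temperature `T`,

  `C_N(s) = ∫ J_tot · (κ_{s⁺} J_tot) dπ_T`,  `J_tot = Σ_i j_i`,  `κ_s = transitionKernel N T T s⁺`,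
  `π_T = gibbsMeasure N T`,

is dominated UNIFORMLY in `N`: there is `B` with `|C_N(s)| ≤ B · N` for every `N` and every `s ≥ 0` (the line uses
it to pass the fixed-time thermodynamic limit under the window integral by dominated convergence).

Proof (tree facts only, no neighbour stub is used).
* `|C_N(s)| ≤ ∫ J_tot² dπ_T` for `N ≥ 1`: the generic bound `LightConeBondHeat.pinnedChain_autocorr_abs_le`
  (`|f g| ≤ (f² + g²)/2` with `g = κ_s f`, Jensen `g² ≤ κ_s(f²)` for the Markov kernel, Gibbs invariance
  `∫ κ_s(f²) dπ_T = ∫ f² dπ_T`) applied to the total current, a continuous observable of exponential class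
  (`pinnedChain_continuous_totalBondCurrent`, `pinnedChain_abs_totalBondCurrent_le_exp` at the admissible weight
  `ϑ = 1/(4T)`, `quarter_inv_temp_admissible`); for `N = 0` both sides vanish (empty sum over `Fin 0`).
* `∫ J_tot² dπ_T ≤ C_J · N` for every `N`: the landed statics `exists_integral_sq_totalCurrent_gibbsMeasure_le`.
Hence `B = C_J`. The hypothesis `0 ≤ s` of the registered signature is not needed (`s⁺ = 0` for `s ≤ 0`).
-/

noncomputable section

namespace Summit.AtomisticToContinuum.FouriersLaw.Theorems.NonBallistic

open MeasureTheory ProbabilityTheory Filter Topology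
open scoped NNReal ENNReal BigOperators
open Literature.MathematicalPhysics.KineticTheory
open Literature.MathematicalPhysics.KineticTheory.HeatConduction
open Summit.AtomisticToContinuum.FouriersLaw.Theorems.LightConeBondHeat

/-- **The total-current autocorrelation is bounded by the static second moment**: for the pinned chain
(`0 < ω₂`, `0 ≤ lam`, `0 < β`, `0 < γ`), `T > 0`, every `N` and every lag `u ≥ 0`,
`|∫ J_tot · (κ_u J_tot) dπ_T| ≤ ∫ J_tot² dπ_T` (`LightConeBondHeat.pinnedChain_autocorr_abs_le` for the total
current, an observable of exponential class at weight `ϑ = 1/(4T)`; `N = 0`: both sides are `0`). [folklore] -/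
theorem abs_totalCurrentAutocorr_le_integral_sq {ω₂ lam β γ : ℝ} (hω : 0 < ω₂) (hl : 0 ≤ lam) (hβ : 0 < β)
    (hγ : 0 < γ) {T : ℝ} (hT : 0 < T) (N : ℕ) (u : ℝ≥0) :
    |∫ x, (∑ i : Fin N, (pinnedChain ω₂ lam β γ).bondCurrent N i x) *
        (∫ y, (∑ i : Fin N, (pinnedChain ω₂ lam β γ).bondCurrent N i y)
          ∂((pinnedChain ω₂ lam β γ).transitionKernel N T T u x))
        ∂((pinnedChain ω₂ lam β γ).gibbsMeasure N T)| ≤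
      ∫ x, (∑ i : Fin N, (pinnedChain ω₂ lam β γ).bondCurrent N i x) ^ 2
        ∂((pinnedChain ω₂ lam β γ).gibbsMeasure N T) := by
  rcases Nat.eq_zero_or_pos N with rfl | hN
  · -- no bond: the total current over `Fin 0` is the empty sum, both sides vanish
    simp
  · exact pinnedChain_autocorr_abs_le hω hl hβ hγ hN hT (quarter_inv_temp_admissible hT).1
      (quarter_inv_temp_admissible hT).2 (pinnedChain_continuous_totalBondCurrent ω₂ lam β γ N)
      (pinnedChain_abs_totalBondCurrent_le_exp hω.le hl hβ.le γ N (quarter_inv_temp_admissible hT).1) u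

/-- **Stub `stub_autocorrelationDomination`** (DOM, registered stub 7 of line `drude-controls-conductance`, R2;
harmonic-true): for the pinned chain (all parameters `> 0`), `T > 0` and the equilibrium total-current
autocorrelation `C` pinned by its defining equation, there is `B` with `|C_N(s)| ≤ B · N` for all `N` and all
`s ≥ 0` — Cauchy–Schwarz/AM–GM in `L²(π_T)` with the `L²(π_T)`-contraction of the equal-temperature kernels
(`abs_totalCurrentAutocorr_le_integral_sq`: `|C_N(s)| ≤ ∫ J_tot² dπ_T`) and the landed statics
`exists_integral_sq_totalCurrent_gibbsMeasure_le` (`∫ J_tot² dπ_T ≤ C_J · N`); `B = C_J`. [folklore] -/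
theorem stub_autocorrelationDomination :
    ∀ ω₂ lam β γ : ℝ, 0 < ω₂ → 0 < lam → 0 < β → 0 < γ → ∀ T : ℝ, 0 < T →
    ∀ C : ℕ → ℝ → ℝ,
      C = (fun (N : ℕ) (s : ℝ) => ∫ x, (∑ i : Fin N, (pinnedChain ω₂ lam β γ).bondCurrent N i x) *
            (∫ y, (∑ i : Fin N, (pinnedChain ω₂ lam β γ).bondCurrent N i y)
              ∂((pinnedChain ω₂ lam β γ).transitionKernel N T T s.toNNReal x))
            ∂((pinnedChain ω₂ lam β γ).gibbsMeasure N T)) →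
      ∃ B : ℝ, ∀ N : ℕ, ∀ s : ℝ, 0 ≤ s → |C N s| ≤ B * (N : ℝ) := by
  intro ω₂ lam β γ hω hl hβ hγ T hT C hC
  obtain ⟨CJ, -, hCJ⟩ := exists_integral_sq_totalCurrent_gibbsMeasure_le (γ := γ) hω hl.le hβ.le hT
  refine ⟨CJ, fun N s _ => ?_⟩
  subst hC
  exact (abs_totalCurrentAutocorr_le_integral_sq hω hl.le hβ hγ hT N s.toNNReal).trans (hCJ N)

end Summit.AtomisticToContinuum.FouriersLaw.Theorems.NonBallistic

end
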